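import Summits.QuantumFields.YangMills.Theorems.UnitScaleTiltFluctuationComparisonRegPrIntLChiV4
import Summits.QuantumFields.YangMills.Theorems.UnitScaleTiltFluctuationComparisonRegPrGlobalSlackOn
import Summits.QuantumFields.YangMills.Theorems.UnitScaleTiltFluctuationComparisonRegPrGlobalSlackKernelMatchingOn
import Summits.QuantumFields.YangMills.Theorems.UnitScaleTiltFluctuationComparisonRegPrGlobalSlackTwoProfile
import HarnessLib

/-!
# `UnitScaleTiltFluctuationComparisonRegPrGlobalSlackTwoProfileV4` — THE v4 TWIN (★★OWNER RULING g26-№14 (F-2b); P22b profile branch, width seat ym-ust-20520-w2 g4; skeleton v5kD; record-free decls imported from `…GlobalSlackTwoProfile`) of `…GlobalSlackTwoProfile` — THE TWO-PROFILE DOOR: KING'S SLACK ROW WITH ITS RATE WEIGHT AT A SECOND LOG-PROFILE `p₁`, ITS χ-RESTRICTED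
# S-E″ CONSUMER, THE ORDER-FOR-PROFILE TRADE IN THE SLACK SUMMAND, AND THE DECIDING CRUX THROUGH THE DOOR (crux `FluctuationComparisonRegPrIntL`, stmt-QuantumFields-20520,
# skeleton v5kC; width-lever lane B «(R1) print's χ of [Balaban1985UV3] (47) back», seat ym-ust-19935-r1 g5)

WHY.  The one located obstruction in the K1a supplier chain that does not depend on the block size (ym-ust-20520-w2 g0 PROGRESS 2/3, lane A NOTES-g2 «dead ends», ideator-1
F-idea1-g15-1) is a CURRENCY mismatch: the g-free Λ-family (G3D-07, C63) and the (28) collar carry polylogarithms `(1 + log g⁻¹)^q` of the running coupling, so the two-run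
bound a finite-order comparison delivers at height `n` reads `C·|𝕋_n|·(θ_{b₀,p₁}(n)²·L^{−a(K−n)} + …)` at a HIGHER log-profile `p₁ > p₀` — not `≤ C′·θ_{b₀,p₀}(n)²·…` with an
`n`-uniform `C′`, which is what the registered texts of 3⁗χ/(i*)χ ask (window AND bound at the record's `(b₀, p₀)`).  For the CRUX the mismatch is harmless: the S-E″ counting
(`GlobalSlackOn.summable_slackRadii`) reads the bound only at the free-fraction heights `n = ⌊K/m⌋` and only through a geometric majorant of `θ`, which EVERY profile has
(`GlobalSlack.θBal_le_geometric_sharp`).  This file makes that a theorem, in the tree's EXISTING generic-weight currency `GlobalSlackKernelMatchingOn.GlobalSupRateWSlackOn S D b₀ p₀ w a σ C`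
(lane A's W-rows; window and slack summand at `(b₀, p₀)`, rate weight `w`) read at `w n := θ_{b₀,p₁}(n)²` — no new definition, no binder edit:

* §1 profile algebra: `θBal_mono_p` (the thresholds are monotone in the log-power), **`θBal_mul_xlog_rpow`** (a polylog loss IS a profile shift:
  `θ_{b₀,p₀}(n)·(1 + log g_n⁻¹)^q = θ_{b₀,p₀+q}(n)`), **`θBal_pow_succ_le_const_mul_pow`** (the ORDER-FOR-PROFILE TRADE in the slack summand: `θ_{b₀,p₁}(n)^{σ+1} ≤ b₀Q^Qe^{1−Q}·θ_{b₀,p₀}(n)^σ`,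
  `Q = p₁ + σ(p₁ − p₀)` — one spare order absorbs every polylog, uniformly in `n`; this is the arithmetic of the «order-8 Λ display» option);
* §2 **`cauchyOn_of_globalSupRateWSlackOn_profile`** (+ the full-window twin `cauchyAtHeights_of_globalSupRateWSlack_profile` and the registered-shape slot
  `levelCauchyOnOfGlobalSupRateWSlackOn_profile_dec`): for `0 < p₀`, any `p₁`, `σ ≥ 7`, `m > (3+a)/a` the row `GlobalSupRateWSlackOn S D b₀ p₀ (θ_{b₀,p₁}²) a σ C` gives
  `PrintChi.PintCauchyOn F γ b₀ p₀ S m D.PintH` — radii ≤ the one-profile radii at `max p₀ p₁`, summable by `summable_slackRadii` there; no block-size threshold;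
* §3 **`regPrIntL_of_recChiV4_slackWOnChi_allL`** : STUB 1's text → T8's text → 2′χ → (∀ odd `L > 1`, ∀ margin `μ ∈ (0,1)`, every record/[7]-constants: `∃ a ∈ (0,1), ∃ p₁`, a coherent
  χ-package family and a polymerisation with `∀ ε₀ ∈ (0, a₀], GlobalSupRateWSlackOn (ChiGood … ε₀ μ) (dataOfV4chi p π) 𝔠.b₀ 𝔠.p₀ (θ_{𝔠.b₀,p₁}²) a σ C`) → `FluctuationComparisonRegPrIntL`,
  through ★r1 g3's engine `regPrIntL_of_dataOnPrintChi` (ONE chain for every odd `L`, the On-χ branch at margin `μ_L`).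
HONEST FRAMING: counting and bookkeeping over hypothesis schemas; nothing of [Balaban1985UV3]/[King1986] asserted; no numerics; registry untouched (`--supports
stmt-QuantumFields-20520`).  The door does not make any stub easier to SUPPLY — it removes the currency objection only.  YM₃ on T³ is a rung, not the Clay problem / a gap.

References: C. King, CMP 102 (1986) 649–677 [King1986] (Thm 3.4 (3.9) p.656, (3.12)–(3.13) p.657, (3.42) p.660); T. Bałaban, CMP 102 (1985) 255–275 [Balaban1985UV3] ((7) p.257,
(28) p.263, (47) p.267, (57) p.270, (61)–(63) pp.271–272).
-/

set_option autoImplicit false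

noncomputable section

open MeasureTheory Filter
open Literature.MathematicalPhysics.QuantumFieldTheory.Balaban1983to89
open Literature.MathematicalPhysics.QuantumFieldTheory.Balaban1983to89.T3ContinuumYM3Torus
open Literature.MathematicalPhysics.QuantumFieldTheory.Balaban1983to89.T3LevelShift
open Literature.MathematicalPhysics.QuantumFieldTheory.Balaban1983to89.T3UnitScaleTilt
open Literature.MathematicalPhysics.QuantumFieldTheory.Balaban1983to89.T3AlphaInputsAC
open Literature.MathematicalPhysics.QuantumFieldTheory.Balaban1983to89.T3AlphaPolymerSocket
open Literature.MathematicalPhysics.QuantumFieldTheory.Balaban1983to89.T3AlphaInputsACTwoRunLevel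
open Summit.QuantumFields.YangMills.Theorems.GlobalSlack
open Summit.QuantumFields.YangMills.Theorems.GlobalSlackKernelMatchingOn (GlobalSupRateWSlackOn globalSupRateWSlackOn_of_full)
open Summit.QuantumFields.YangMills.Theorems.GlobalSlackLocalToGlobal (GlobalSupRateWSlack)
open Summit.QuantumFields.YangMills.Theorems.PrintChi (PintCauchyOn ChiGood)

/-! ## §1 Profile algebra of the thresholds `θ_{b₀,p}(i) = g_i·b₀(1 + log g_i⁻¹)^p` -/

namespace Summit.QuantumFields.YangMills.Theorems.GlobalSlackOn

variable {F : T3Family} {γ : ℝ}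

-- (record-free `θBal_mono_p`: imported from the v3 module, not restated)

-- (record-free `θBal_mul_xlog_rpow`: imported from the v3 module, not restated)

-- (record-free `θBal_pow_succ_le_const_mul_pow`: imported from the v3 module, not restated)

/-! ## §2 The χ-restricted S-E″ consumer of the generic-weight row at the rate weight `θ_{b₀,p₁}²` -/

-- (record-free `cauchyOn_of_globalSupRateWSlackOn_profile`: imported from the v3 module, not restated)

-- (record-free `cauchyAtHeights_of_globalSupRateWSlack_profile`: imported from the v3 module, not restated)

-- (record-free `levelCauchyOnOfGlobalSupRateWSlackOn_profile_dec`: imported from the v3 module, not restated)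

end Summit.QuantumFields.YangMills.Theorems.GlobalSlackOn

/-! ## §3 The deciding crux through the door: 2′χ and the second-profile row ON print's χ at every odd block size -/

namespace Summit.QuantumFields.YangMills.Theorems.InteriorExcision

open Literature.MathematicalPhysics.QuantumFieldTheory.Balaban1983to89.T3UnitLawDensityEML (ℰp)
open Literature.MathematicalPhysics.QuantumFieldTheory.Balaban1983to89.T3TiltDescent
open Literature.MathematicalPhysics.QuantumFieldTheory.Balaban1983to89.T3RegularMinimiser
open Literature.MathematicalPhysics.QuantumFieldTheory.Balaban1983to89.T3PrintedRegularMinimiser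
open Literature.MathematicalPhysics.QuantumFieldTheory.Balaban1983to89.T3PrintedMinimiserExistence
open Literature.MathematicalPhysics.QuantumFieldTheory.Balaban1983to89.T3SmallLiftHistory
open Literature.MathematicalPhysics.QuantumFieldTheory.Balaban1983to89.T3LogComparisonSocket
open Literature.MathematicalPhysics.QuantumFieldTheory.Balaban1983to89.T3LowerAlongMinimisersSplit (MinimisersIn8At)
open Literature.MathematicalPhysics.QuantumFieldTheory.Balaban1983to89.T3InteriorExcision
open Summit.QuantumFields.YangMills.Theorems.PrintChi
open Summit.QuantumFields.YangMills.Theorems.GlobalSlackOn (levelCauchyOnOfGlobalSupRateWSlackOn_profile_dec)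
open Summit.QuantumFields.YangMills.Theorems.LogComparisonRepAtHeightsOn (atHeights printChiSets)

/-- **THE DATUM-LEVEL TRIPLE AT ONE BLOCK SIZE from 2′χ(L) and the second-profile slack row on the doubly-`ChiGood(μ_L)`-good data** (margin `μ_L = 1 − 2/(L√L)`; second profile
`p₁` chosen by the supplier after the record): ★r1 g3's `dataOnPrintChiAt_of_laneRecordsChi_slackOnChi` with the second-profile slot `levelCauchyOnOfGlobalSupRateWSlackOn_profile_dec`
in place of the one-profile S-E″. [cite: King1986, Thm 3.4 (3.9) p.656; Balaban1985UV3, (41) p.266, (47) p.267] -/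
theorem dataOnPrintChiAt_of_laneRecordsV4Chi_slackWOnChi (L : ℕ) (hLo : Odd L) (hL : 1 < L)
    (h2 : Summit.QuantumFields.YangMills.Theorems.AlphaInputsT3ACv4RecChi L)
    (hIμ :
      ∀ (𝔠 : Summit.QuantumFields.Balaban3D.Proofs.Primitives.AlphaConsts L (Summit.QuantumFields.Balaban3D.Carriers.suGroupModel 2).N)
        (a₀ a₁ : ℝ), 0 < a₀ → 0 < a₁ → 𝔠.B₃ * a₁ ≤ a₀ →
        ∃ a : ℝ, 0 < a ∧ ∃ p₁ : ℝ, ∃ γB : ℝ, 0 < γB ∧ ∀ (F : T3Family) (γ : ℝ) (hF : F.L = L) (hγ : 0 < γ), γ ≤ γB →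
          ∀ (hγ1 : γ ≤ (min (hF ▸ 𝔠).gamma0 1) ^ 2),
            Summit.QuantumFields.YangMills.Theorems.AlphaInputsT3AC.OfV4ChiAt F (hF ▸ 𝔠) a₀ a₁ →
            ∃ (p : ∀ K, Summit.QuantumFields.YangMills.Theorems.AlphaInputsT3AC.PkgAtV4Chi F (hF ▸ 𝔠) γ hγ hγ1 K),
              (∀ K, (p K).a₀ = a₀ ∧ (p K).a₁ = a₁) ∧
              ∃ (π : Summit.QuantumFields.YangMills.Theorems.AlphaInputsT3AC.PolymerT3 F) (σ : ℕ) (C : ℝ), 7 ≤ σ ∧ 0 ≤ C ∧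
                ∀ ε₀ : ℝ, 0 < ε₀ → ε₀ ≤ a₀ →
                  GlobalSupRateWSlackOn
                    (fun K n h V => ChiGood F γ (hF ▸ 𝔠).b₀ (hF ▸ 𝔠).p₀ ε₀ (1 - 2 / ((L : ℝ) * Real.sqrt L)) (n := n) (K := K) h V)
                    (Summit.QuantumFields.YangMills.Theorems.AlphaInputsT3AC.dataOfV4chi p π) (hF ▸ 𝔠).b₀ (hF ▸ 𝔠).p₀
                    (fun n => θBal F.L γ (hF ▸ 𝔠).b₀ p₁ n ^ 2) a σ C) :
    ∃ (b₁ p₁ : ℝ), ∀ (b₀ p₀ : ℝ), b₁ ≤ b₀ → p₁ ≤ p₀ → 0 < b₀ → 2 < p₀ →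
      ∃ ε₁ : ℝ, 0 < ε₁ ∧ ∀ (ε₀ : ℝ), 0 < ε₀ → ε₀ ≤ ε₁ → ∃ m₀ : ℕ, ∀ (m : ℕ), m₀ ≤ m →
        ∃ γ₁ : ℝ, 0 < γ₁ ∧ ∀ (F : T3Family) (γ : ℝ), F.L = L → 0 < γ → γ ≤ γ₁ →
          ∃ D : AlphaDataT3 F γ,
            (∀ (K n : ℕ) (hnK : n < K) (V : GaugeField (F.P n) 0 (Matrix.specialUnitaryGroup (Fin 2) ℂ)),
              PlaqSmall (θBal F.L γ b₀ p₀ n) V →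
                D.Umin K (K - n) (D.triv K (K - n))
                    (fieldShift (F.sitesPerDir_eq (m := F.m) (K := K) (j := K - n) (m' := F.m) (K' := n) (j' := 0) (by omega)) V) ∈
                  regFibrePr F n K hnK.le ε₀ V ∧
                wilsonAction4 (D.Umin K (K - n) (D.triv K (K - n))
                    (fieldShift (F.sitesPerDir_eq (m := F.m) (K := K) (j := K - n) (m' := F.m) (K' := n) (j' := 0) (by omega)) V)) =
                  minActionRegPr F n K hnK.le ε₀ V) ∧
            TwoSidedRepOn F γ b₀ p₀ (atHeights (printChiSets D b₀ p₀)) ε₀ D.PintH D.EcstH D.RmH ∧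
            PintCauchyOn F γ b₀ p₀
              (fun K n h V => ChiGood F γ b₀ p₀ ε₀ (1 - 2 / ((F.L : ℝ) * Real.sqrt F.L)) (n := n) (K := K) h V) m D.PintH := by
  obtain ⟨b₁, p₁, hrec⟩ := h2
  refine ⟨b₁, p₁, fun b₀ p₀ hb1 hp1 hb hp => ?_⟩
  obtain ⟨𝔠, a₀, a₁, hcb, hcp, ha0, ha1, hw, h𝔠⟩ := hrec b₀ p₀ hb1 hp1
  subst hcb
  subst hcp
  obtain ⟨a, ha, q₁, γB, hγB, hBC⟩ := hIμ 𝔠 a₀ a₁ ha0 ha1 hw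
  obtain ⟨εs, hεs, hS⟩ := levelCauchyOnOfGlobalSupRateWSlackOn_profile_dec L hLo hL a ha
  refine ⟨min a₀ εs, lt_min ha0 hεs, fun ε₀ h0 h1 => ?_⟩
  have h1a : ε₀ ≤ a₀ := h1.trans (min_le_left _ _)
  have h1s : ε₀ ≤ εs := h1.trans (min_le_right _ _)
  obtain ⟨m₀, hm₀⟩ := hS ε₀ h0 h1s
  refine ⟨m₀, fun m hm => ?_⟩
  obtain ⟨γT, hγT, -, hT⟩ := Summit.QuantumFields.YangMills.Theorems.LogComparisonAlphaAdapter.exists_gamma_thresholds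
    (B₃ := 𝔠.B₃) 𝔠.b₀_pos 𝔠.p₀_pos ha1 𝔠.B₃_pos.le h0
  have hg0 : 0 < (min 𝔠.gamma0 1) ^ 2 := pow_pos (lt_min 𝔠.gamma0_pos one_pos) 2
  obtain ⟨γs, hγs, hS'⟩ := hm₀ m hm 𝔠.b₀ 𝔠.p₀ hb hp
  refine ⟨min (min γB (min γT ((min 𝔠.gamma0 1) ^ 2))) γs,
    lt_min (lt_min hγB (lt_min hγT hg0)) hγs, fun F γ hF hγ hγ₁ => ?_⟩
  subst hF
  have hγB' : γ ≤ γB := hγ₁.trans ((min_le_left _ _).trans (min_le_left _ _))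
  have hγT' : γ ≤ γT := hγ₁.trans ((min_le_left _ _).trans ((min_le_right _ _).trans (min_le_left _ _)))
  have hγ1 : γ ≤ (min 𝔠.gamma0 1) ^ 2 := hγ₁.trans ((min_le_left _ _).trans ((min_le_right _ _).trans (min_le_right _ _)))
  have hγs' : γ ≤ γs := hγ₁.trans (min_le_right _ _)
  obtain ⟨p, hp', π, σ, C, hσ, hC0, hG⟩ := hBC F γ rfl hγ hγB' hγ1 (h𝔠 F rfl)
  obtain ⟨hT1, hT2, hT3⟩ := hT F.L F.hL.2.le γ hγ hγT'
  refine ⟨Summit.QuantumFields.YangMills.Theorems.AlphaInputsT3AC.dataOfV4chi p π, fun K n hnK V hV => ?_, ?_, ?_⟩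
  · exact Summit.QuantumFields.YangMills.Theorems.AlphaInputsT3AC.dataOfV4chi_uminTriv p π K n hnK ε₀
      (by rw [(hp' K).2]; exact hT1 n) (hT2 n) (by rw [(hp' K).1]; exact h1a) V hV
  · exact Summit.QuantumFields.YangMills.Theorems.AlphaInputsT3AC.twoSidedRepOnPrintChi_dataOfV4chi p π hp' ε₀ h0 h1a hT1 hT2 hT3
  · exact hS' F γ rfl hγ hγs' _ (Summit.QuantumFields.YangMills.Theorems.AlphaInputsT3AC.dataOfV4chi p π) q₁ σ C hσ hC0 (hG ε₀ h0 h1a)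

/-- **THE DECIDING CRUX THROUGH THE SECOND-PROFILE DOOR, ONE CHAIN FOR EVERY ODD BLOCK SIZE**: STUB 1's text (window positivity via
`OneStepSubmersion.posOnSmall_of_oneStepSmallLift`), T8's text, 2′χ, and — for every odd `L > 1`, every margin `μ ∈ (0,1)`, every record and [7]-constants — a rate `a ∈ (0,1)`, a second
profile `p₁`, a coherent χ-package family and a polymerisation whose datum satisfies the GENERIC-WEIGHT slack row with rate weight `θ_{𝔠.b₀,p₁}(n)²` on the doubly-`ChiGood(ε₀, μ)`-good
data for every `0 < ε₀ ≤ a₀`, give `FluctuationComparisonRegPrIntL` (engine `regPrIntL_of_dataOnPrintChi`, On-χ branch at `μ_L` for EVERY `L`, no `7 ≤ L` split).  Polylog losses of the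
running coupling in the rate summand are admitted (`GlobalSlackOn.θBal_mul_xlog_rpow`: `p₁ = 𝔠.p₀ + q/2`); in the slack summand one spare order absorbs them
(`GlobalSlackOn.θBal_pow_succ_le_const_mul_pow`). [cite: King1986, Thm 3.4 (3.9) p.656, (3.42) p.660; Balaban1985UV3, (41) p.266, (47) p.267, (57) p.270, Thm 2 p.272; Balaban1985Variational, Thm 1 (8) p.279; Balaban1987RG1, (0.4) p.253] -/
theorem regPrIntL_of_recChiV4_slackWOnChi_allL
    (h1 : ∀ L : ℕ, ∃ κ δ₀ : ℝ, κ * Real.sqrt L ≤ 1 ∧ 0 < δ₀ ∧ ∀ F : T3Family, F.L = L → OneStepSmallLift F ℰp κ δ₀)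
    (hT8 : ∀ L : ℕ, Odd L → 1 < L → ∃ a₀ a₁ B₃ : ℝ, 0 < a₀ ∧ 0 < a₁ ∧ 0 < B₃ ∧
      Thm1GlobalMinAt L a₀ a₁ B₃ ∧ MinimisersIn8At L a₀ a₁ B₃)
    (h2 : ∀ L : ℕ, Odd L → 1 < L → Summit.QuantumFields.YangMills.Theorems.AlphaInputsT3ACv4RecChi L)
    (hIW : ∀ (L : ℕ), Odd L → 1 < L → ∀ (μ : ℝ), 0 < μ → μ < 1 →
      ∀ (𝔠 : Summit.QuantumFields.Balaban3D.Proofs.Primitives.AlphaConsts L (Summit.QuantumFields.Balaban3D.Carriers.suGroupModel 2).N)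
        (a₀ a₁ : ℝ), 0 < a₀ → 0 < a₁ → 𝔠.B₃ * a₁ ≤ a₀ →
        ∃ a : ℝ, 0 < a ∧ a < 1 ∧ ∃ p₁ : ℝ, ∃ γB : ℝ, 0 < γB ∧ ∀ (F : T3Family) (γ : ℝ) (hF : F.L = L) (hγ : 0 < γ), γ ≤ γB →
          ∀ (hγ1 : γ ≤ (min (hF ▸ 𝔠).gamma0 1) ^ 2),
            Summit.QuantumFields.YangMills.Theorems.AlphaInputsT3AC.OfV4ChiAt F (hF ▸ 𝔠) a₀ a₁ →
            ∃ (p : ∀ K, Summit.QuantumFields.YangMills.Theorems.AlphaInputsT3AC.PkgAtV4Chi F (hF ▸ 𝔠) γ hγ hγ1 K),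
              (∀ K, (p K).a₀ = a₀ ∧ (p K).a₁ = a₁) ∧
              ∃ (π : Summit.QuantumFields.YangMills.Theorems.AlphaInputsT3AC.PolymerT3 F) (σ : ℕ) (C : ℝ), 7 ≤ σ ∧ 0 ≤ C ∧
                ∀ ε₀ : ℝ, 0 < ε₀ → ε₀ ≤ a₀ →
                  GlobalSupRateWSlackOn (fun K n h V => ChiGood F γ (hF ▸ 𝔠).b₀ (hF ▸ 𝔠).p₀ ε₀ μ (n := n) (K := K) h V)
                    (Summit.QuantumFields.YangMills.Theorems.AlphaInputsT3AC.dataOfV4chi p π) (hF ▸ 𝔠).b₀ (hF ▸ 𝔠).p₀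
                    (fun n => θBal F.L γ (hF ▸ 𝔠).b₀ p₁ n ^ 2) a σ C) :
    FluctuationComparisonRegPrIntL :=
  regPrIntL_of_dataOnPrintChi hT8
    (fun L hLo hL => by
      have hμ := muL_pos_lt_one hL
      exact dataOnPrintChiAt_of_laneRecordsV4Chi_slackWOnChi L hLo hL (h2 L hLo hL) fun 𝔠 a₀ a₁ ha0 ha1 hw => by
        obtain ⟨a, ha, -, p₁, γB, hγB, hall⟩ := hIW L hLo hL _ hμ.1 hμ.2 𝔠 a₀ a₁ ha0 ha1 hw
        exact ⟨a, ha, p₁, γB, hγB, hall⟩)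
    (Summit.QuantumFields.YangMills.Theorems.OneStepSubmersion.posOnSmall_of_oneStepSmallLift h1)

end Summit.QuantumFields.YangMills.Theorems.InteriorExcision

end
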